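import Summits.BirchSwinnertonDyer.BirchSwinnertonDyer.Theorems.PrintCf2SplitBadEisensteinTwoOrdinaryFiltrationAtTwo
import HarnessLib

/-!
# Crux `PrintCf2.SplitBadTwoRankOneOfFacts` (item stmt-BirchSwinnertonDyer-20368), road α: the ordinary filtration at `(K, 𝔭 ∣ 2)` of a model of
# `49a1^{(d)}` WITH THE TWIST SIGN NAMED — `s(σ) = +1` iff `res σ` fixes `ι(√d) ∈ K̄` (i.e. `s = χ_d`)

Cell `bsd-print-cf2`, width seat `bsd-line-cf2-p1-w2` g8; `--supports stmt-BirchSwinnertonDyer-20368` (helper). HONEST FRAMING: nothing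
here closes a crux or a stub; BSD is not proved by any of this; no summit statement is proved by this seat. THEOREMS ONLY (no
definition, no named fact, no `sorry`). FILE 7 of the -w2 g8 pinning series (the «NEXT BRICK» of `TURNKEY-20368-pinning-w2g8.md`).

WHY. p640618's `EisensteinTwo.stub_ordinaryFiltrationAtTwo` (and its chain `ordinaryFiltration_rat` ∘ `ordinaryFiltration_twist` ∘
`ordinaryFiltration_baseChange_of_inertiaDeg_eq_one`) exports the Greenberg datum of a split-bad member with ANONYMOUS signs `s₁ = s₂ = ±1`
chosen per `σ`; the source of the sign — the twisting isomorphism of `Rank1Residual.Additive.exists_addEquiv_geomPrimaryTorsion_of_model_twist_sign`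
commutes with `σ` iff `σ√d = √d` — is forgotten. The exact dyadic values of road α's S3c₂ (`#W*(K_v)`, `#W*(K_v̄)`, the local characters of the
pinned module) are functions of `[d]₂` THROUGH this sign. This file re-exports the chain with the sign NAMED.

* §1 `ordinaryFiltration_twist_named` — `EisensteinTwo.ordinaryFiltration_twist` with the (anti-)equivariance of `e` keyed to a predicate `Q`
  on `Γ_K`, returning the signed clauses WITH `s = +1` if `Q (res σ)`, `s = −1` if `¬ Q (res σ)`;
* §2 `ordinaryFiltration_baseChange_named` — `EisensteinTwo.ordinaryFiltration_baseChange_of_inertiaDeg_eq_one` with the predicate transported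
  along the conjugator `τ` of the two routes `Γ_{K_𝔭} → Γ_ℚ` (`Q (τ⁻¹ · res^K_ℚ(res σ) · τ)`);
* §3 **`ordinaryFiltration_two_namedSign`** — for `W/ℚ` with `C₁ • W = cm7.quadraticTwist d` (`d ≠ 0`), `K` a number field, `𝔭 ∣ 2` with
  `f(𝔭|2) = 1`: `∃ C α`, `α² = α − 2`, and for every `σ ∈ Γ_{K_𝔭}` of Frobenius degree `n`: with `s = +1` if
  `res σ • ι(√d) = ι(√d)` and `s = −1` if `res σ • ι(√d) = −ι(√d)` (`ι = absClosureEmbedding ℚ K`, `√d = WeierstrassCurve.geomSqrt d`), the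
  quotient clause `±αⁿ ↦ s·αⁿ` and the line clause `s·ε(res σ)·α^{−n}` — the predicate transport is `conj_smul_geomSqrt_eq_iff` (`τ√d = ±√d`)
  and `absGaloisRestrict_smul_geomSqrt_eq_iff` (`ι(res g • √d) = g • ι√d`); `smul_absClosureEmbedding_geomSqrt_eq_or` (every `g ∈ Γ_K`
  fixes or negates `ι√d`).
FILE 8 `…CMPrimaryLocalTypesNamed` reads the NAMED local characters of the CM summands off this datum. beyond-print theorem: no.

References: [SilvermanAEC2009] X.5 Cor. 5.4, 5.4.1; R. Greenberg, LNM 1716 (1999) §2 pp. 62–63, 69–70; [SerreAbelianLadic1968] Ch. I §2.1;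
[JetchevSkinnerWan2017] §3.3 Prop. 3.3.4 Case 3(b).
-/

noncomputable section

open scoped Classical

set_option linter.dupNamespace false
set_option autoImplicit false

namespace Summit.BirchSwinnertonDyer.BirchSwinnertonDyer.Theorems.PrintCf2.CMPrimes

open NumberField IsDedekindDomain Field WeierstrassCurve
  Literature.NumberTheory.EllipticCurves Literature.NumberTheory.EllipticCurves.GreenbergSelmer
  Literature.NumberTheory.GaloisRepresentations Literature.NumberTheory.Automorphic
  Summit.BirchSwinnertonDyer.BirchSwinnertonDyer.Theorems.PrintCf2.EisensteinTwo

/-! ## §1 Twist transport with the sign NAMED by a predicate on `Γ_K` -/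

section Twist

variable {K : Type} [Field K] [NumberField K] {V W : WeierstrassCurve K} {p : ℕ} [hp : Fact p.Prime]
  {v : HeightOneSpectrum (𝓞 K)}

/-- **Quadratic-twist transport of the ordinary filtration with the sign NAMED.** As `EisensteinTwo.ordinaryFiltration_twist`, but the
equivariance / anti-equivariance of `e : V[p^∞] ≃+ W[p^∞]` is keyed to a predicate `Q` on `Γ_K` (`Q σ`: `e` commutes with `σ`; `¬ Q σ`:
anti-commutes) — for the twisting isomorphism of `W ≅ V ⊗ χ_d`, `Q σ ⟺ σ√d = √d` — and the signed clauses on `e(C)` are returned WITH the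
sign `s = +1` if `Q (res σ)`, `s = −1` if `¬ Q (res σ)`. [cite: SilvermanAEC2009, X.5 Cor. 5.4] [cite: GreenbergLNM1716, §2 pp. 69–70] -/
theorem ordinaryFiltration_twist_named {Q : absoluteGaloisGroup K → Prop}
    (e : ↥(V.geomPrimaryTorsion p) ≃+ ↥(W.geomPrimaryTorsion p))
    (hepos : ∀ σ : absoluteGaloisGroup K, Q σ → ∀ m, e (σ • m) = σ • e m)
    (heneg : ∀ σ : absoluteGaloisGroup K, ¬ Q σ → ∀ m, e (σ • m) = -(σ • e m))
    (C : AddSubgroup (V.geomPrimaryTorsion p)) (α : ℤ_[p]ˣ)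
    (hchar : ∀ (σ : absoluteGaloisGroup (v.adicCompletion K)) (n : ℕ), IsFrobPow σ (n : ℤ) →
      (∀ (k : ℕ) (x : V.geomPrimaryTorsion p), p ^ k • x ∈ C →
        ∀ N : ℤ, ((N : ℤ_[p]) - ((α ^ n : ℤ_[p]ˣ) : ℤ_[p])) ∈ (Ideal.span {(p : ℤ_[p]) ^ k} : Ideal ℤ_[p]) →
          absGaloisRestrict K (v.adicCompletion K) σ • x - N • x ∈ C) ∧
      (∀ (k : ℕ) (c : V.geomPrimaryTorsion p), c ∈ C → p ^ k • c = 0 →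
        ∀ N : ℤ, ((N : ℤ_[p]) -
            ((GaloisRep.cyclotomicCharacter K p (absGaloisRestrict K (v.adicCompletion K) σ) * (α⁻¹) ^ n :
              ℤ_[p]ˣ) : ℤ_[p])) ∈ (Ideal.span {(p : ℤ_[p]) ^ k} : Ideal ℤ_[p]) →
          absGaloisRestrict K (v.adicCompletion K) σ • c = N • c)) :
    ∀ (σ : absoluteGaloisGroup (v.adicCompletion K)) (n : ℕ), IsFrobPow σ (n : ℤ) →
      ∀ s : ℤ, ((Q (absGaloisRestrict K (v.adicCompletion K) σ) ∧ s = 1) ∨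
          (¬ Q (absGaloisRestrict K (v.adicCompletion K) σ) ∧ s = -1)) →
        (∀ (k : ℕ) (x : W.geomPrimaryTorsion p), p ^ k • x ∈ C.map e.toAddMonoidHom →
          ∀ N : ℤ, ((N : ℤ_[p]) - s * ((α ^ n : ℤ_[p]ˣ) : ℤ_[p])) ∈ (Ideal.span {(p : ℤ_[p]) ^ k} : Ideal ℤ_[p]) →
            absGaloisRestrict K (v.adicCompletion K) σ • x - N • x ∈ C.map e.toAddMonoidHom) ∧
        (∀ (k : ℕ) (c : W.geomPrimaryTorsion p), c ∈ C.map e.toAddMonoidHom → p ^ k • c = 0 →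
          ∀ N : ℤ, ((N : ℤ_[p]) - s *
              ((GaloisRep.cyclotomicCharacter K p (absGaloisRestrict K (v.adicCompletion K) σ) * (α⁻¹) ^ n :
                ℤ_[p]ˣ) : ℤ_[p])) ∈ (Ideal.span {(p : ℤ_[p]) ^ k} : Ideal ℤ_[p]) →
            absGaloisRestrict K (v.adicCompletion K) σ • c = N • c) := by
  set C' : AddSubgroup (W.geomPrimaryTorsion p) := C.map e.toAddMonoidHom with hC'
  have hmem' : ∀ c : V.geomPrimaryTorsion p, e c ∈ C' ↔ c ∈ C := fun c ↦ by
    rw [hC', AddSubgroup.mem_map]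
    constructor
    · rintro ⟨c₀, hc₀, h⟩
      rw [AddEquiv.coe_toAddMonoidHom] at h
      rwa [← e.injective h]
    · exact fun h ↦ ⟨c, h, rfl⟩
  intro σ n hσn s hs
  set g := absGaloisRestrict K (v.adicCompletion K) σ with hg
  obtain ⟨hquot, hline⟩ := hchar σ n hσn
  rcases hs with ⟨hQ, rfl⟩ | ⟨hQ, rfl⟩
  · have hpos := hepos g hQ
    refine ⟨fun k x hx N hN ↦ ?_, fun k c hc hpc N hN ↦ ?_⟩
    · obtain ⟨x₀, rfl⟩ : ∃ x₀, e x₀ = x := ⟨e.symm x, e.apply_symm_apply x⟩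
      have hx₀ : p ^ k • x₀ ∈ C := by rw [← hmem', map_nsmul]; exact hx
      rw [Int.cast_one, one_mul] at hN
      have h := hquot k x₀ hx₀ N hN
      rw [← hg] at h
      rw [← hpos x₀, ← map_zsmul, ← map_sub, hmem']
      exact h
    · obtain ⟨c₀, rfl⟩ : ∃ c₀, e c₀ = c := ⟨e.symm c, e.apply_symm_apply c⟩
      have hc₀ : c₀ ∈ C := (hmem' c₀).1 hc
      have hpc₀ : p ^ k • c₀ = 0 := e.injective (by rw [map_nsmul, hpc, map_zero])
      rw [Int.cast_one, one_mul] at hN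
      have h := hline k c₀ hc₀ hpc₀ N hN
      rw [← hg] at h
      rw [← hpos c₀, h, map_zsmul]
  · have hneg := heneg g hQ
    refine ⟨fun k x hx N hN ↦ ?_, fun k c hc hpc N hN ↦ ?_⟩
    · obtain ⟨x₀, rfl⟩ : ∃ x₀, e x₀ = x := ⟨e.symm x, e.apply_symm_apply x⟩
      have hx₀ : p ^ k • x₀ ∈ C := by rw [← hmem', map_nsmul]; exact hx
      have hN' : (((-N : ℤ) : ℤ_[p]) - ((α ^ n : ℤ_[p]ˣ) : ℤ_[p])) ∈ (Ideal.span {(p : ℤ_[p]) ^ k} : Ideal ℤ_[p]) := by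
        have : (((-N : ℤ) : ℤ_[p]) - ((α ^ n : ℤ_[p]ˣ) : ℤ_[p])) =
            -(((N : ℤ_[p]) - (-1 : ℤ) * ((α ^ n : ℤ_[p]ˣ) : ℤ_[p]))) := by push_cast; ring
        rw [this]
        exact Submodule.neg_mem _ hN
      have h := hquot k x₀ hx₀ (-N) hN'
      rw [← hg] at h
      have h1 : g • e x₀ = -(e (g • x₀)) := by rw [hneg x₀, neg_neg]
      have key : g • e x₀ - N • e x₀ = -(e (g • x₀ - (-N) • x₀)) := by
        rw [h1, map_sub, map_zsmul, neg_zsmul]; abel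
      rw [key, neg_mem_iff, hmem']
      exact h
    · obtain ⟨c₀, rfl⟩ : ∃ c₀, e c₀ = c := ⟨e.symm c, e.apply_symm_apply c⟩
      have hc₀ : c₀ ∈ C := (hmem' c₀).1 hc
      have hpc₀ : p ^ k • c₀ = 0 := e.injective (by rw [map_nsmul, hpc, map_zero])
      have hN' : (((-N : ℤ) : ℤ_[p]) -
          ((GaloisRep.cyclotomicCharacter K p g * (α⁻¹) ^ n : ℤ_[p]ˣ) : ℤ_[p])) ∈
          (Ideal.span {(p : ℤ_[p]) ^ k} : Ideal ℤ_[p]) := by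
        have : (((-N : ℤ) : ℤ_[p]) -
            ((GaloisRep.cyclotomicCharacter K p g * (α⁻¹) ^ n : ℤ_[p]ˣ) : ℤ_[p])) =
            -(((N : ℤ_[p]) - (-1 : ℤ) *
              ((GaloisRep.cyclotomicCharacter K p g * (α⁻¹) ^ n : ℤ_[p]ˣ) : ℤ_[p]))) := by
          push_cast; ring
        rw [this]
        exact Submodule.neg_mem _ hN
      have h := hline k c₀ hc₀ hpc₀ (-N) hN'
      rw [← hg] at h
      have hneg' : g • e c₀ = -(e (g • c₀)) := by rw [hneg c₀, neg_neg]
      rw [hneg', h, map_zsmul, neg_zsmul, neg_neg]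

end Twist

/-! ## §2 Base-change transport with the predicate transported along the conjugator -/

section BaseChange

variable (W : WeierstrassCurve ℚ) {p : ℕ} [hp : Fact p.Prime]
  (K : Type) [Field K] [NumberField K] (v : HeightOneSpectrum (𝓞 ℚ))
  (𝔭 : HeightOneSpectrum (𝓞 K)) [h𝔭v : 𝔭.asIdeal.LiesOver v.asIdeal]

/-- **Base change of the NAMED-sign datum at a degree-one prime.** As `EisensteinTwo.ordinaryFiltration_baseChange_of_inertiaDeg_eq_one`, with the
predicate `Q` on `Γ_ℚ` transported: the output clauses for `σ ∈ Γ_{K_𝔭}` carry the sign `+1` iff `Q (τ⁻¹ · res^K_ℚ(res σ) · τ)` for the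
conjugator `τ ∈ Γ_ℚ` of the two routes `Γ_{K_𝔭} → Γ_ℚ` (door-c4's `exists_absGaloisRestrict_adicCompletion_conj`), returned existentially.
[cite: SerreAbelianLadic1968, Ch. I §2.1] [cite: JetchevSkinnerWan2017, §3.3 Prop. 3.3.4 Case 3(b) (arXiv:1512.06894 p. 13)] -/
theorem ordinaryFiltration_baseChange_named (hf : 𝔭.asIdeal.inertiaDeg (𝓞 ℚ) = 1) {Q : absoluteGaloisGroup ℚ → Prop}
    (C : AddSubgroup (W.geomPrimaryTorsion p)) (α : ℤ_[p]ˣ)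
    (hchar : ∀ (σ : absoluteGaloisGroup (v.adicCompletion ℚ)) (n : ℕ), IsFrobPow σ (n : ℤ) →
      ∀ s : ℤ, ((Q (absGaloisRestrict ℚ (v.adicCompletion ℚ) σ) ∧ s = 1) ∨
          (¬ Q (absGaloisRestrict ℚ (v.adicCompletion ℚ) σ) ∧ s = -1)) →
        (∀ (k : ℕ) (x : W.geomPrimaryTorsion p), p ^ k • x ∈ C →
          ∀ N : ℤ, ((N : ℤ_[p]) - s * ((α ^ n : ℤ_[p]ˣ) : ℤ_[p])) ∈ (Ideal.span {(p : ℤ_[p]) ^ k} : Ideal ℤ_[p]) →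
            absGaloisRestrict ℚ (v.adicCompletion ℚ) σ • x - N • x ∈ C) ∧
        (∀ (k : ℕ) (c : W.geomPrimaryTorsion p), c ∈ C → p ^ k • c = 0 →
          ∀ N : ℤ, ((N : ℤ_[p]) - s *
              ((GaloisRep.cyclotomicCharacter ℚ p (absGaloisRestrict ℚ (v.adicCompletion ℚ) σ) * (α⁻¹) ^ n :
                ℤ_[p]ˣ) : ℤ_[p])) ∈ (Ideal.span {(p : ℤ_[p]) ^ k} : Ideal ℤ_[p]) →
            absGaloisRestrict ℚ (v.adicCompletion ℚ) σ • c = N • c)) :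
    ∃ (τ : absoluteGaloisGroup ℚ) (C' : AddSubgroup ((W.baseChange K).geomPrimaryTorsion p)),
      ∀ (σ : absoluteGaloisGroup (𝔭.adicCompletion K)) (n : ℕ), IsFrobPow σ (n : ℤ) →
        ∀ s : ℤ, ((Q (τ⁻¹ * absGaloisRestrict ℚ K (absGaloisRestrict K (𝔭.adicCompletion K) σ) * τ) ∧ s = 1) ∨
            (¬ Q (τ⁻¹ * absGaloisRestrict ℚ K (absGaloisRestrict K (𝔭.adicCompletion K) σ) * τ) ∧ s = -1)) →
          (∀ (k : ℕ) (x : (W.baseChange K).geomPrimaryTorsion p), p ^ k • x ∈ C' →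
            ∀ N : ℤ, ((N : ℤ_[p]) - s * ((α ^ n : ℤ_[p]ˣ) : ℤ_[p])) ∈
                (Ideal.span {(p : ℤ_[p]) ^ k} : Ideal ℤ_[p]) →
              absGaloisRestrict K (𝔭.adicCompletion K) σ • x - N • x ∈ C') ∧
          (∀ (k : ℕ) (c : (W.baseChange K).geomPrimaryTorsion p), c ∈ C' → p ^ k • c = 0 →
            ∀ N : ℤ, ((N : ℤ_[p]) - s *
                ((GaloisRep.cyclotomicCharacter K p (absGaloisRestrict K (𝔭.adicCompletion K) σ) * (α⁻¹) ^ n :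
                  ℤ_[p]ˣ) : ℤ_[p])) ∈ (Ideal.span {(p : ℤ_[p]) ^ k} : Ideal ℤ_[p]) →
              absGaloisRestrict K (𝔭.adicCompletion K) σ • c = N • c) := by
  letI := (adicCompletionOfLiesOver ℚ K v 𝔭).toAlgebra
  obtain ⟨τ, hτc⟩ := SchneiderFreeAdditiveX3.exists_absGaloisRestrict_adicCompletion_conj K v 𝔭
  set Φ := absGaloisRestrict (v.adicCompletion ℚ) (𝔭.adicCompletion K) with hΦ
  set e := primaryBaseChangeEquiv K W p with he_def
  set g : W.geomPrimaryTorsion p ≃+ W.geomPrimaryTorsion p :=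
    DistribMulAction.toAddEquiv (W.geomPrimaryTorsion p) τ with hgdef
  set f : W.geomPrimaryTorsion p ≃+ (W.baseChange K).geomPrimaryTorsion p := g.trans e with hf_def
  have hf_apply : ∀ m, f m = e (τ • m) := fun m => rfl
  have hkey : ∀ (σ : absoluteGaloisGroup (𝔭.adicCompletion K)) (m : W.geomPrimaryTorsion p),
      absGaloisRestrict K (𝔭.adicCompletion K) σ • f m =
        f (absGaloisRestrict ℚ (v.adicCompletion ℚ) (Φ σ) • m) := fun σ m => by
    rw [hf_apply, hf_apply, he_def]
    exact SchneiderFreeAdditiveX3.absGaloisRestrict_smul_primaryBaseChangeEquiv_smul W K v 𝔭 hτc σ m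
  have hmem' : ∀ c : W.geomPrimaryTorsion p, f c ∈ C.map f.toAddMonoidHom ↔ c ∈ C := fun c ↦ by
    rw [AddSubgroup.mem_map]
    constructor
    · rintro ⟨c₀, hc₀, h⟩
      rw [AddEquiv.coe_toAddMonoidHom] at h
      rwa [← f.injective h]
    · exact fun h ↦ ⟨c, h, rfl⟩
  -- the ℚ-side element acting is `res_v(Φ σ) = τ⁻¹ · res^K_ℚ(res σ) · τ`
  have hgal : ∀ σ : absoluteGaloisGroup (𝔭.adicCompletion K),
      absGaloisRestrict ℚ (v.adicCompletion ℚ) (Φ σ) =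
        τ⁻¹ * absGaloisRestrict ℚ K (absGaloisRestrict K (𝔭.adicCompletion K) σ) * τ := fun σ ↦ by
    rw [hτc σ]; group
  refine ⟨τ, C.map f.toAddMonoidHom, fun σ n hσ s hs ↦ ?_⟩
  have hΦσ : IsFrobPow (Φ σ) (n : ℤ) :=
    SchneiderFreeAdditiveX3.isFrobPow_absGaloisRestrict_adicCompletion_of_inertiaDeg_eq_one K v 𝔭 hf hσ
  have hs' : (Q (absGaloisRestrict ℚ (v.adicCompletion ℚ) (Φ σ)) ∧ s = 1) ∨
      (¬ Q (absGaloisRestrict ℚ (v.adicCompletion ℚ) (Φ σ)) ∧ s = -1) := by rwa [hgal σ]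
  obtain ⟨hquot, hline⟩ := hchar (Φ σ) n hΦσ s hs'
  refine ⟨fun k x hx N hN ↦ ?_, fun k c hc hpk N hN ↦ ?_⟩
  · obtain ⟨x₀, rfl⟩ : ∃ x₀, f x₀ = x := ⟨f.symm x, f.apply_symm_apply x⟩
    have hx₀ : p ^ k • x₀ ∈ C := by rw [← hmem', map_nsmul]; exact hx
    rw [hkey σ x₀, ← map_zsmul, ← map_sub, hmem']
    exact hquot k x₀ hx₀ N hN
  · obtain ⟨c₀, rfl⟩ : ∃ c₀, f c₀ = c := ⟨f.symm c, f.apply_symm_apply c⟩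
    have hc₀ : c₀ ∈ C := (hmem' c₀).1 hc
    have hpk₀ : p ^ k • c₀ = 0 := f.injective (by rw [map_nsmul, hpk, map_zero])
    rw [SchneiderFreeAdditiveX3.cyclotomicCharacter_adicCompletion_eq_of_conj K v 𝔭 p hτc σ] at hN
    rw [hkey σ c₀, hline k c₀ hc₀ hpk₀ N hN, map_zsmul]

end BaseChange

/-! ## §3 The split-bad CM class: the ordinary filtration at `(K, 𝔭)` with the twist sign NAMED `σ√d = ±√d` -/

section Class

variable (W : WeierstrassCurve ℚ) [W.IsElliptic] (K : Type) [Field K] [NumberField K]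

/-- Transport of the predicate «fixes `√d`» along the conjugator: for `τ, r ∈ Γ_ℚ`,
`(τ⁻¹ r τ) √d = √d ↔ r √d = √d` (`τ√d = ±√d`). [folklore] -/
theorem conj_smul_geomSqrt_eq_iff {d : ℚ} (τ r : absoluteGaloisGroup ℚ) :
    (τ⁻¹ * r * τ) • WeierstrassCurve.geomSqrt d = WeierstrassCurve.geomSqrt d ↔
      r • WeierstrassCurve.geomSqrt d = WeierstrassCurve.geomSqrt d := by
  have key : (τ⁻¹ * r * τ) • WeierstrassCurve.geomSqrt d = WeierstrassCurve.geomSqrt d ↔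
      r • (τ • WeierstrassCurve.geomSqrt d) = τ • WeierstrassCurve.geomSqrt d := by
    rw [mul_smul, mul_smul, inv_smul_eq_iff]
  rw [key]
  rcases WeierstrassCurve.map_geomSqrt (absoluteGaloisGroup.toAlgEquiv ℚ τ) d with h | h
  · change τ • WeierstrassCurve.geomSqrt d = _ at h
    rw [h]
  · change τ • WeierstrassCurve.geomSqrt d = _ at h
    rw [h, smul_neg, neg_inj]

/-- Transport of «fixes `√d`» along `res : Γ_K → Γ_ℚ`: `res(g) √d = √d ↔ g • ι(√d) = ι(√d)`, `ι : ℚ̄ → K̄` the chosen embedding. [folklore] -/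
theorem absGaloisRestrict_smul_geomSqrt_eq_iff {d : ℚ} (g : absoluteGaloisGroup K) :
    absGaloisRestrict ℚ K g • WeierstrassCurve.geomSqrt d = WeierstrassCurve.geomSqrt d ↔
      g • absClosureEmbedding ℚ K (WeierstrassCurve.geomSqrt d) = absClosureEmbedding ℚ K (WeierstrassCurve.geomSqrt d) := by
  rw [← absGaloisRestrict_apply_smul]
  exact ⟨fun h ↦ by rw [h], fun h ↦ (absClosureEmbedding ℚ K).injective h⟩

omit [W.IsElliptic] in
/-- **THE ORDINARY FILTRATION AT `(K, 𝔭)` FOR A MODEL OF `49a1^{(d)}`, WITH THE TWIST SIGN NAMED.** `W/ℚ` elliptic with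
`C₁ • W = cm7.quadraticTwist d` (`d ≠ 0`), `K` a number field, `𝔭 ∣ 2` with `f(𝔭|2) = 1`. On `E_K[2^∞](K̄)` there are `C` and a unit `α`,
`α² = α − 2`, such that every `σ ∈ Γ_{K_𝔭}` of Frobenius degree `n` acts on `E[2^∞] ⧸ C` as `s·αⁿ` (graded) and on `C[2^k]` as
`s·ε(res σ)·α^{−n}`, where NOW `s = +1` if `res σ` FIXES `ι(√d) ∈ K̄` and `s = −1` if `res σ` NEGATES it (`ι = absClosureEmbedding ℚ K`;
`s = χ_d(res σ)`, the quadratic twist character). p640618's `stub_ordinaryFiltrationAtTwo` is this statement with the sign forgotten.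
[cite: SilvermanAEC2009, X.5 Cor. 5.4 and 5.4.1] [cite: GreenbergLNM1716, §2 pp. 62–63 and p. 70] -/
theorem ordinaryFiltration_two_namedSign {d : ℚ} (hd : d ≠ 0) (C₁ : VariableChange ℚ) (hC₁ : C₁ • W = cm7.quadraticTwist d)
    (𝔭 : HeightOneSpectrum (𝓞 K)) (h𝔭 : ((2 : ℕ) : 𝓞 K) ∈ 𝔭.asIdeal) (hf : 𝔭.asIdeal.inertiaDeg (𝓞 ℚ) = 1) :
    ∃ (C : AddSubgroup ((W.baseChange K).geomPrimaryTorsion 2)) (α : ℤ_[2]ˣ),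
      (α : ℤ_[2]) ^ 2 = (α : ℤ_[2]) - 2 ∧
      ∀ (σ : absoluteGaloisGroup (𝔭.adicCompletion K)) (n : ℕ), IsFrobPow σ (n : ℤ) →
        ∀ s : ℤ,
          ((absGaloisRestrict K (𝔭.adicCompletion K) σ • absClosureEmbedding ℚ K (WeierstrassCurve.geomSqrt d) =
              absClosureEmbedding ℚ K (WeierstrassCurve.geomSqrt d) ∧ s = 1) ∨
           (absGaloisRestrict K (𝔭.adicCompletion K) σ • absClosureEmbedding ℚ K (WeierstrassCurve.geomSqrt d) =
              -absClosureEmbedding ℚ K (WeierstrassCurve.geomSqrt d) ∧ s = -1)) →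
          (∀ (k : ℕ) (x : (W.baseChange K).geomPrimaryTorsion 2), 2 ^ k • x ∈ C →
            ∀ N : ℤ, ((N : ℤ_[2]) - s * ((α ^ n : ℤ_[2]ˣ) : ℤ_[2])) ∈ (Ideal.span {(2 : ℤ_[2]) ^ k} : Ideal ℤ_[2]) →
              absGaloisRestrict K (𝔭.adicCompletion K) σ • x - N • x ∈ C) ∧
          (∀ (k : ℕ) (c : (W.baseChange K).geomPrimaryTorsion 2), c ∈ C → 2 ^ k • c = 0 →
            ∀ N : ℤ, ((N : ℤ_[2]) - s *
                ((GaloisRep.cyclotomicCharacter K 2 (absGaloisRestrict K (𝔭.adicCompletion K) σ) * (α⁻¹) ^ n :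
                  ℤ_[2]ˣ) : ℤ_[2])) ∈ (Ideal.span {(2 : ℤ_[2]) ^ k} : Ideal ℤ_[2]) →
              absGaloisRestrict K (𝔭.adicCompletion K) σ • c = N • c) := by
  haveI : Fact (Nat.Prime 2) := ⟨Nat.prime_two⟩
  haveI : NeZero (2 : ℚ) := ⟨two_ne_zero⟩
  have hpv : ((2 : ℕ) : 𝓞 ℚ) ∈ (Summit.BirchSwinnertonDyer.Rank1Residual.X11b.ratPlace 2).asIdeal :=
    (natCast_mem_asIdeal_iff_eq_primesEquiv_symm (Summit.BirchSwinnertonDyer.Rank1Residual.X11b.ratPlace 2) Fact.out).mpr rfl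
  haveI := SchneiderFreeAdditiveX3.liesOver_of_natCast_mem hpv h𝔭
  -- the untwisted datum on `49a1`
  have hord : ¬ ((2 : ℕ) : ℤ) ∣ cm7.frobeniusTrace 2 := by rw [GoldfeldGoodTwists.frobeniusTrace_cm7_two]; decide
  obtain ⟨C₀, α, hα, hchar₀⟩ := ordinaryFiltration_rat cm7 2 hpv not_two_dvd_minimalDiscriminantInt_cm7 hord
  have hα' : (α : ℤ_[2]) ^ 2 = (α : ℤ_[2]) - 2 := by
    rw [hα, GoldfeldGoodTwists.frobeniusTrace_cm7_two]; push_cast; ring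
  -- the twisting isomorphism with its signs
  obtain ⟨e, -, hepos, heneg⟩ :=
    Summit.BirchSwinnertonDyer.Rank1Residual.Additive.exists_addEquiv_geomPrimaryTorsion_of_model_twist_sign 2 cm7 hd
      (W := W) ⟨C₁⁻¹, by rw [← hC₁, inv_smul_smul]⟩
  have heneg' : ∀ σ : absoluteGaloisGroup ℚ, ¬ σ • WeierstrassCurve.geomSqrt d = WeierstrassCurve.geomSqrt d →
      ∀ m, e (σ • m) = -(σ • e m) := by
    intro σ hσ
    rcases WeierstrassCurve.map_geomSqrt (absoluteGaloisGroup.toAlgEquiv ℚ σ) d with h | h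
    · exact absurd h hσ
    · exact heneg σ h
  have htw := ordinaryFiltration_twist_named (Q := fun g ↦ g • WeierstrassCurve.geomSqrt d = WeierstrassCurve.geomSqrt d)
    e hepos heneg' C₀ α hchar₀
  obtain ⟨τ, C, hchar⟩ := ordinaryFiltration_baseChange_named W K (Summit.BirchSwinnertonDyer.Rank1Residual.X11b.ratPlace 2) 𝔭 hf
    (Q := fun g ↦ g • WeierstrassCurve.geomSqrt d = WeierstrassCurve.geomSqrt d) (C₀.map e.toAddMonoidHom) α htw
  refine ⟨C, α, hα', fun σ n hσ s hs ↦ hchar σ n hσ s ?_⟩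
  -- translate the sign predicate
  have hiff := (conj_smul_geomSqrt_eq_iff (d := d) τ (absGaloisRestrict ℚ K (absGaloisRestrict K (𝔭.adicCompletion K) σ))).trans
    (absGaloisRestrict_smul_geomSqrt_eq_iff K (d := d) (absGaloisRestrict K (𝔭.adicCompletion K) σ))
  rcases hs with ⟨h, hs⟩ | ⟨h, hs⟩
  · exact Or.inl ⟨hiff.mpr h, hs⟩
  · refine Or.inr ⟨fun h' ↦ ?_, hs⟩
    have h'' := hiff.mp h'
    rw [h''] at h
    -- `x = -x` forces `x = 0`, but `√d ≠ 0`
    have hzero : absClosureEmbedding ℚ K (WeierstrassCurve.geomSqrt d) = 0 := by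
      have h2 : (2 : AlgebraicClosure K) * absClosureEmbedding ℚ K (WeierstrassCurve.geomSqrt d) = 0 := by
        rw [two_mul]
        nth_rewrite 2 [h]
        rw [add_neg_cancel]
      exact (mul_eq_zero.mp h2).resolve_left two_ne_zero
    exact WeierstrassCurve.geomSqrt_ne_zero hd ((map_eq_zero _).mp hzero)

omit [W.IsElliptic] in
/-- Every `g ∈ Γ_K` fixes or negates `ι(√d) ∈ K̄` (`res g ∈ Γ_ℚ` sends `√d` to `±√d`, `map_geomSqrt`). [folklore] -/
theorem smul_absClosureEmbedding_geomSqrt_eq_or (d : ℚ) (g : absoluteGaloisGroup K) :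
    g • absClosureEmbedding ℚ K (WeierstrassCurve.geomSqrt d) = absClosureEmbedding ℚ K (WeierstrassCurve.geomSqrt d) ∨
      g • absClosureEmbedding ℚ K (WeierstrassCurve.geomSqrt d) = -absClosureEmbedding ℚ K (WeierstrassCurve.geomSqrt d) := by
  rw [← absGaloisRestrict_apply_smul]
  rcases WeierstrassCurve.map_geomSqrt (absoluteGaloisGroup.toAlgEquiv ℚ (absGaloisRestrict ℚ K g)) d with h | h
  · change absGaloisRestrict ℚ K g • WeierstrassCurve.geomSqrt d = _ at h
    exact Or.inl (by rw [h])
  · change absGaloisRestrict ℚ K g • WeierstrassCurve.geomSqrt d = _ at h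
    exact Or.inr (by rw [h, map_neg])

end Class

end Summit.BirchSwinnertonDyer.BirchSwinnertonDyer.Theorems.PrintCf2.CMPrimes

end
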